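import Summits.Ventures.PercRepro2.CaseOneThickeningT
import Summits.Ventures.PercRepro2.CaseOneMarkCoincidences
import Summits.Ventures.PercRepro2.CaseOneMarkLeafOB
import Summits.Ventures.PercRepro2.CaseOneMarkLeaf
import Summits.Ventures.PercRepro2.CaseOneRootLeafAtA3B

/-!
# The anchors of the six-form calculus that come for free: the every-pair classes
(blind cell PercRepro2, p1 g30)

Several closed classes of the rung were proved at EVERY threshold pair `(c₀, c₁)` with `c₀, c₁ ≥ 0`
(`iiExprT_nonneg_of_…`, `iExprT_nonneg_of_…`): the coincidences `o = b`, `o = a₁`, `o = a₃`,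
`a₁ = a₃`, the mark leaves `o` at `b`, `b` at `o`, `o` at the root `a₁`, and the root `a₂` pendant at
the statement vertex; and `b = a₃` at every pair satisfying the odds condition, which the T-pair
does (`odds_t`). Since the T-pair `(Dto, Dt)` is a pair of probabilities, the T-world forms hold
on all of them, so with the four-form theorems of the same classes the SIX forms hold for every
weight vector: **`closedAtT_of_o_eq_b`**, **`closedAtT_of_o_eq_a1`**, **`closedAtT_of_o_eq_a3`**,
**`closedAtT_of_a1_eq_a3`**, **`closedAtT_of_b_eq_a3`**, **`closedAtT_of_a2_eq_a3`**, **`closedAtT_of_o_leaf_b`**,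
**`closedAtT_of_b_leaf_o`**, **`closedAtT_of_o_leaf_root`**, **`closedAtT_of_a2_leaf_at_a3`** —
the first anchors of `ClosedAtT`, hence (`closedAtT_of_moves`, `closedAtT_of_a2_edges`) of
everything reachable from them by thickenings, pendant steps and `a₂`-edges. Own code; standard
axioms.
-/

namespace Summit.Ventures.PercRepro2

namespace CaseOne

section Anchors
variable {V : Type*} {E : Type*} [Fintype E] [DecidableEq E] [Fintype V] [DecidableEq V]
  {R : Type*} [Field R] [LinearOrder R] [IsStrictOrderedRing R]
variable {ends : E → Sym2 V} {e₀ : E}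

omit [Fintype V] [DecidableEq V] in
/-- The T-pair is a pair of probabilities. -/
lemma Dto_nonneg {p : E → R} (hp : IsProbVec p) (o a₁ a₂ a₃ : V) : 0 ≤ Dto p ends o a₁ a₂ a₃ :=
  prob_nonneg hp _

omit [Fintype V] [DecidableEq V] in
/-- The T-pair is a pair of probabilities. -/
lemma Dt_nonneg {p : E → R} (hp : IsProbVec p) (a₁ a₂ a₃ : V) : 0 ≤ Dt p ends a₁ a₂ a₃ :=
  prob_nonneg hp _

/-- **`o = b`: the six forms at every statement vertex.** -/
theorem closedAtT_of_o_eq_b (a₁ a₂ a₃ b : V) : ClosedAtT (R := R) b a₁ a₂ b E ends a₃ := by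
  intro p hp
  obtain ⟨h1, h2, h3, h4⟩ := closedAt_of_o_eq_b (R := R) (E := E) (ends := ends) a₁ a₂ a₃ b p hp
  exact ⟨h1, h2, iiExprT_nonneg_of_o_eq_b hp a₁ a₂ a₃ b _ _ (Dto_nonneg hp _ _ _ _) (Dt_nonneg hp _ _ _),
    h3, h4, iExprT_nonneg_of_o_eq_b hp a₁ a₂ a₃ b _ _ (Dto_nonneg hp _ _ _ _) (Dt_nonneg hp _ _ _)⟩

/-- **`o = a₁`: the six forms at every statement vertex.** -/
theorem closedAtT_of_o_eq_a1 (a₁ a₂ a₃ b : V) : ClosedAtT (R := R) a₁ a₁ a₂ b E ends a₃ := by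
  intro p hp
  obtain ⟨h1, h2, h3, h4⟩ := closedAt_of_o_eq_a1 (R := R) (E := E) (ends := ends) a₁ a₂ a₃ b p hp
  exact ⟨h1, h2, iiExprT_nonneg_of_o_eq_a1 hp a₁ a₂ a₃ b _ _ (Dto_nonneg hp _ _ _ _),
    h3, h4, iExprT_nonneg_of_o_eq_a1 hp a₁ a₂ a₃ b _ _ (Dto_nonneg hp _ _ _ _)⟩

/-- **`o = a₃`: the six forms.** -/
theorem closedAtT_of_o_eq_a3 (a₁ a₂ a₃ b : V) : ClosedAtT (R := R) a₃ a₁ a₂ b E ends a₃ := by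
  intro p hp
  exact ⟨zSplitII_of_o_eq_a3 p hp a₁ a₂ a₃ b, zSplitIIQ_of_o_eq_a3 p hp a₁ a₂ a₃ b,
    iiExprT_nonneg_of_o_eq_a3 p hp a₁ a₂ a₃ b _ _ (Dto_nonneg hp _ _ _ _),
    zSplitI_of_o_eq_a3 p hp a₁ a₂ a₃ b, zSplitIQ_of_o_eq_a3 p hp a₁ a₂ a₃ b,
    iExprT_nonneg_of_o_eq_a3 p hp a₁ a₂ a₃ b _ _ (Dto_nonneg hp _ _ _ _)⟩

/-- **`a₁ = a₃`: the six forms.** -/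
theorem closedAtT_of_a1_eq_a3 (o a₁ a₂ b : V) : ClosedAtT (R := R) o a₁ a₂ b E ends a₁ := by
  intro p hp
  exact ⟨zSplitII_of_a1_eq_a3 p hp o a₁ a₂ b, zSplitIIQ_of_a1_eq_a3 p hp o a₁ a₂ b,
    iiExprT_nonneg_of_a1_eq_a3 p hp o a₁ a₂ b _ _ (Dt_nonneg hp _ _ _),
    zSplitI_of_a1_eq_a3 p hp o a₁ a₂ b, zSplitIQ_of_a1_eq_a3 p hp o a₁ a₂ b,
    iExprT_nonneg_of_a1_eq_a3 p hp o a₁ a₂ b _ _ (Dt_nonneg hp _ _ _)⟩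

/-- **`b = a₃`: the six forms** (the T-pair satisfies the odds condition, `odds_t`). -/
theorem closedAtT_of_b_eq_a3 (o a₁ a₂ a₃ : V) : ClosedAtT (R := R) o a₁ a₂ a₃ E ends a₃ := by
  intro p hp
  have hodds := odds_t (ends := ends) (a₁ := a₁) (a₂ := a₂) (a₃ := a₃) p hp o
  exact ⟨zSplitII_of_b_eq_a3 p hp o a₁ a₂ a₃, zSplitIIQ_of_b_eq_a3 p hp o a₁ a₂ a₃,
    iiExprT_nonneg_of_b_eq_a3 p hp o a₁ a₂ a₃ _ _ hodds, zSplitI_of_b_eq_a3 p hp o a₁ a₂ a₃,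
    zSplitIQ_of_b_eq_a3 p hp o a₁ a₂ a₃, iExprT_nonneg_of_b_eq_a3 p hp o a₁ a₂ a₃ _ _ hodds⟩

omit [Fintype V] [DecidableEq V] [IsStrictOrderedRing R] in
/-- **`a₂ = a₃`: the six forms** (every form vanishes). -/
theorem closedAtT_of_a2_eq_a3 (o a₁ a₂ b : V) : ClosedAtT (R := R) o a₁ a₂ b E ends a₂ := by
  intro p hp
  refine ⟨zSplitII_of_a2_eq_a3 p o a₁ a₂ b, zSplitIIQ_of_a2_eq_a3 p o a₁ a₂ b, ?_,
    zSplitI_of_a2_eq_a3 p o a₁ a₂ b, zSplitIQ_of_a2_eq_a3 p o a₁ a₂ b, ?_⟩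
  · unfold ZSplitIIT
    rw [iiExprT_eq_zero_of_a2_eq_a3]
  · unfold ZSplitIT
    rw [iExprT_eq_zero_of_a2_eq_a3]

/-- **`o` a leaf at `b`: the six forms at every statement vertex.** -/
theorem closedAtT_of_o_leaf_b {o a₁ a₂ b : V} (hl : IsLeafAt ends b o e₀) (h1 : a₁ ≠ o)
    (h2 : a₂ ≠ o) (a₃ : V) : ClosedAtT (R := R) o a₁ a₂ b E ends a₃ := by
  intro p hp
  obtain ⟨k1, k2, k3, k4⟩ := closedAt_of_o_leaf_b (R := R) hl h1 h2 a₃ p hp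
  by_cases h3 : a₃ = o
  · subst h3
    obtain ⟨_, _, t3, _, _, t6⟩ := closedAtT_of_o_eq_a3 (R := R) (E := E) (ends := ends) a₁ a₂ a₃ b p hp
    exact ⟨k1, k2, t3, k3, k4, t6⟩
  · exact ⟨k1, k2, iiExprT_nonneg_of_o_leaf_b hp hl h1 h2 h3 _ _ (Dto_nonneg hp _ _ _ _)
      (Dt_nonneg hp _ _ _), k3, k4, iExprT_nonneg_of_o_leaf_b hp hl h1 h2 h3 _ _
      (Dto_nonneg hp _ _ _ _) (Dt_nonneg hp _ _ _)⟩

/-- **`b` a leaf at `o`: the six forms at every statement vertex.** -/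
theorem closedAtT_of_b_leaf_o {o a₁ a₂ b : V} (hl : IsLeafAt ends o b e₀) (h1 : a₁ ≠ b)
    (h2 : a₂ ≠ b) (a₃ : V) : ClosedAtT (R := R) o a₁ a₂ b E ends a₃ := by
  intro p hp
  obtain ⟨k1, k2, k3, k4⟩ := closedAt_of_b_leaf_o (R := R) hl h1 h2 a₃ p hp
  by_cases h3 : a₃ = b
  · subst h3
    obtain ⟨_, _, t3, _, _, t6⟩ := closedAtT_of_b_eq_a3 (R := R) (E := E) (ends := ends) o a₁ a₂ a₃ p hp
    exact ⟨k1, k2, t3, k3, k4, t6⟩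
  · exact ⟨k1, k2, iiExprT_nonneg_of_b_leaf_o hp hl h1 h2 h3 _ _ (Dto_nonneg hp _ _ _ _)
      (Dt_nonneg hp _ _ _), k3, k4, iExprT_nonneg_of_b_leaf_o hp hl h1 h2 h3 _ _
      (Dto_nonneg hp _ _ _ _) (Dt_nonneg hp _ _ _)⟩

/-- **`o` a leaf at the root `a₁`: the six forms at every statement vertex.** -/
theorem closedAtT_of_o_leaf_root {o a₁ a₂ : V} (hl : IsLeafAt ends a₁ o e₀) (h2 : o ≠ a₂)
    (a₃ b : V) : ClosedAtT (R := R) o a₁ a₂ b E ends a₃ := by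
  intro p hp
  obtain ⟨k1, k2, k3, k4⟩ := closedAt_of_o_leaf_root (R := R) hl h2 a₃ b p hp
  exact ⟨k1, k2, iiExprT_nonneg_of_o_leaf hp hl h2 a₃ b _ _ (Dto_nonneg hp _ _ _ _), k3, k4,
    iExprT_nonneg_of_o_leaf hp hl h2 a₃ b _ _ (Dto_nonneg hp _ _ _ _)⟩

omit [Fintype V] [DecidableEq V] in
/-- **The root `a₂` pendant at the statement vertex: the six forms.** -/
theorem closedAtT_of_a2_leaf_at_a3 {o a₁ a₂ a₃ b : V} (hl : IsLeafAt ends a₃ a₂ e₀) (h1 : a₁ ≠ a₂)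
    (ho : o ≠ a₂) (hb : b ≠ a₂) : ClosedAtT (R := R) o a₁ a₂ b E ends a₃ := by
  intro p hp
  obtain ⟨k1, k2, k3, k4⟩ := closedAt_of_a2_leaf_at_a3 (R := R) hl h1 ho hb p hp
  exact ⟨k1, k2, iiExprT_nonneg_of_a2_leaf_at_a3 hp hl h1 ho hb _ _ (Dto_nonneg hp _ _ _ _), k3, k4,
    iExprT_nonneg_of_a2_leaf_at_a3 hp hl h1 ho hb _ _ (Dto_nonneg hp _ _ _ _)⟩

end Anchors

end CaseOne

end Summit.Ventures.PercRepro2
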